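import Summits.Ventures.PercRepro.LemmaBPlusK5Def

/-!
# Faces of `K₅`: kernel slices 32 … 35 (part I)

Each theorem is one `decide +kernel` at default heartbeats (≈ 55 s: the 1024-row table of the marking
plus ≤ 22 000 face points in sub-mask loops); generated by `tools/gen_k5.py`.
-/

namespace PercRepro

namespace Examples

open MultiGraph

/-- Slice 32: joins `u ∈ [943, 951)` of the faces of `K₅` (15552 face points). -/
theorem k5_slice_32 : k5.FacesSRange ![0, 1, 2, 3] 943 951 := by decide +kernel

/-- Slice 33: joins `u ∈ [951, 957)` of the faces of `K₅` (20412 face points). -/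
theorem k5_slice_33 : k5.FacesSRange ![0, 1, 2, 3] 951 957 := by decide +kernel

/-- Slice 34: joins `u ∈ [957, 959)` of the faces of `K₅` (13122 face points). -/
theorem k5_slice_34 : k5.FacesSRange ![0, 1, 2, 3] 957 959 := by decide +kernel

/-- Slice 35: joins `u ∈ [959, 966)` of the faces of `K₅` (21951 face points). -/
theorem k5_slice_35 : k5.FacesSRange ![0, 1, 2, 3] 959 966 := by decide +kernel

end Examples

end PercRepro
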